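import Summits.ResolutionOfSingularities.ResolutionOfSingularities.Theorems.UniversalCellsCampaignW82FrobeniusTwistGraded
import HarnessLib

/-!
# [OURS · L1 W8.2] The FINITE-MODIFICATION («normalise the twists, never re-resolve») form of the Frobenius-twist step
# of slot W8.2 — campaign statements, Theses-free module

Cell `res-hironaka` (run/shared/lean/pub/res-hironaka/), LADDER-RESOLUTION rung L (RESCUE), slot W8.2 of
plan/RESCUE-SEED.md («PRIME-FIELD / UNIVERSALITY TRANSFER instead of descent»), host route `UniversalCells`, host
item `PrimeFieldToPerfect` (stmt-ResolutionOfSingularities-15233); second door `UniformComplexity`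
`PrimeModelTransfer` (stmt-ResolutionOfSingularities-8933) — the forms below are stated at an ARBITRARY constant
field `M` of characteristic `p`, so they serve both doors (door 2: `M` algebraically closed). Statement-only file
(typer res-L1-type-o6 for the two-lane OURS desk; sibling of `…CampaignW82TwistExponentBounded.lean` p515114 and of
res-L1-s82-pv-1's `…CampaignW82SelectionGraded.lean` p514240): one parametric predicate, two pointwise OURS `Prop`s,
pure-logic anchors; NOTHING is proved about resolution of singularities here and nothing is asserted.

WHY THIS FILE. The residual of slot W8.2 in Frobenius-twist form (`FrobeniusTwistStepAt p M n` /
`FrobeniusTwistStepRegularAt p M n`, p485672) asks, for each `X₀`, for SOME exponent `e` and SOME proper birational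
`π : Y ⟶ X₀^{(p^e)}` with `Y` smooth over `M(t)`. Three strengthenings of this «∃ e ∃ π» are by now NAMED and refuted
BY NAME at grade `1` for every constant field: the exponent pinned to `0` (`SmoothModelStepRegularAt`, p502587 /
p508560), a UNIFORM bound on the exponent (`FrobeniusTwistStepBounded(Regular)At`, `…Uniform(Regular)At`, p515114 /
p513490), and «EVERY resolution of a smooth `X₀` is smooth» (`ResolutionsOfSmoothAreSmooth`, p514240 / p512610). The
fourth natural strengthening is (s2) of Cruxes/PrimeFieldToPerfect/Disproof.lean §4 = strategist census N3
(Cruxes/PrimeFieldToPerfect/STRATEGY-CENSUS.md, «the normalisation of `X₀ ⊗ K^{1/p^m}` is SMOOTH for `m ≫ 0` (true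
for curves): FALSE for surfaces»): take `π` FINITE — i.e. (for geometrically integral `X₀`, whose twists are
integral) take `Y` to be the NORMALISATION of the twist and never blow up. THIS FILE gives that form NAMES —
`HasSmoothFiniteTwistModel p K f₀` and the graded steps `FrobeniusTwistStepFiniteAt p M n` /
`FrobeniusTwistStepFiniteRegularAt p M n` — so that the provers' theorems on it can be recorded BY NAME: on the
positive side the curve case (normalisation over the perfect closure; nothing of it is in the tree under these
names), on the negative side res-L1-s82-pv-2's announced rung «NORMALISING THE TWISTS NEVER SUFFICES from dimension
2» (cell bus 2026-08-27T08:24:39Z; algebra landed as p515046 `…CampaignW82TwistNormalAlgebra.lean`: the surface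
`x^p − t + yz = 0` over `M(t)` is regular and geometrically integral, and every Frobenius twist of level `m ≥ 1` is
the NORMAL NON-REGULAR `A_{p−1}` point `u^p = yz`, so by the tree's `isIso_of_isFinite_of_isBirational` no finite
birational modification of any twist is smooth; the disprover's sorried near-miss `twistedSurface_normal_not_regular`
is the `u^p + y² + z²` cousin). The by-name links are the provers', NOT proved here: this module imports no proof
file and decides nothing.

CONTENT (non-embedded summit idiom; Mathlib `iterateFrobenius K p e`, `AlgebraicGeometry.IsFinite`):

* `HasSmoothFiniteTwistModel p K f₀` — SOME twist `X₀ ×_{K,Frob^e} Spec K` has a FINITE birational model smooth over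
  `K` (the predicate `HasSmoothFrobeniusTwistModel p K f₀` of p485672 with `IsProper π` sharpened to `IsFinite π`);
  implies it (`hasSmoothFrobeniusTwistModel_of_hasSmoothFiniteTwistModel`, Mathlib: finite ⇒ proper).
* `FrobeniusTwistStepFiniteAt p M n` / `FrobeniusTwistStepFiniteRegularAt p M n` — the hypothesis block of
  `PerfectionStepAt M n` VERBATIM ⇒ every (regular) separated `X₀` of finite type, dimension `≤ n`,
  `IntegralOverPerfectClosure`, has `HasSmoothFiniteTwistModel p (RatFunc M) f₀`; they imply `FrobeniusTwistStepAt p M n`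
  / `FrobeniusTwistStepRegularAt p M n` (anchors), and the full form implies the regular one.
* anchors (pure logic / transport): the inlined bodies (`hasSmoothFiniteTwistModel_iff`, `frobeniusTwistStepFiniteAt_iff`,
  `frobeniusTwistStepFiniteRegularAt_iff`, all `Iff.rfl`), finite ⇒ proper, forgetting regularity, and the vacuity
  anchor `hasSmoothFiniteTwistModel_of_smooth` (`e = 0`: `Frob^0 = id`, Mathlib `iterateFrobenius_zero`; an
  isomorphism is finite and birational).

HONEST FRAMING. The `def`s below are OURS — campaign statements that REPLACE THE ROLE of §17 ¶2, p.89 l.59–62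
read with §2 p.4 l.22–24 of H. Hironaka's manuscript *Resolution of singularities in positive characteristics*
(2017-03-23, [Hironaka2017]; typed AS PRINTED as `Literature.AlgebraicGeometry.Hironaka2017.S17Methodology.U89_3` /
`U89_3_ours`; locators as in the lane-signed p469608, layout lines p.89 L28–L31 / p.4 L21–L23): they name the
CHEAPEST model the finite level could be asked to supply (the normalised twist), so that its failure from dimension
`2` can be cited by name next to the residual. NOT statements of the manuscript; nothing attributed to its author;
no typed candidate used even as a hypothesis. AI transcription, weaker than expert review; nothing here is progress
on resolution of singularities in positive characteristic; no claim beyond the kernel.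

BUILD RULE (cell, director-resolution 2026-08-26T18:53:29Z (B)): OURS vocabulary file, THESES-FREE BY BIRTH —
imports only the Theses-free p485672 (`…CampaignW82FrobeniusTwistGraded`, cone p481193 / p469608 / p475047) and
`HarnessLib`; `AlgebraicGeometry.IsFinite` and its `IsProper` instance come with Mathlib's `Morphisms.Proper`
through that cone.

BARRIERS (`Literature/Barriers/ResolutionOfSingularities/`): `RegularNotGeometricallyRegular.lean` (Kollár's curve
`y² = x^p − t`: the first twist `y² = (x − t)^p` NORMALISES to a line — the finite form is the right one for
curves); the surface `x^p − t + yz` (every twist normal and singular) is the obstruction the graded statements are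
typed TO BE HIT by at `n = 2`; `FrobeniusTwistResolution.lean` motivates `IntegralOverPerfectClosure` as in the
siblings; `InseparableBaseChangeResolution.lean` is not crossed.

VACUITY SELF-CHECK: `HasSmoothFiniteTwistModel p K f₀` is true when `f₀` is smooth (`e = 0`, `π = (pullback.fst)⁻¹`
along `Spec (Frob^0) = 𝟙`: anchor `hasSmoothFiniteTwistModel_of_smooth`), false for `X₀ = Spec 𝔽_p(t^{1/p})` over
`𝔽_p(t)` (it implies `HasSmoothFrobeniusTwistModel`, false there — barrier decl `not_hasResolution_Spec_frobTwist`);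
the steps (prime `p`) are trivially true at `n = ⊥`, never
trivially false as typed (the hypothesis block follows from `ResolutionInChar p`), NOT implied by the summit (a
resolution supplies proper, not finite, models) — hence informative at every grade `n ≥ 2` — and NOT monotone in
`n`; composite `p` cannot occur (`Fact p.Prime`).

## References (vocabulary and locators only; nothing cited as a premise)
* H. Hironaka, ms. 2017-03-23, §17 ¶2 p.89 l.59–62; §2 p.4 l.22–24 — under adjudication, quoted for the
  role replaced, not asserted. [Hironaka2017]
* J. Kollár, *Lectures on Resolution of Singularities* (2007), 1.19 (curves over non-perfect fields) —
  context, not used. [Kollar2007]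
* Zs. Patakfalvi, J. Waldron, *Singularities of general fibers and the LMMP*, arXiv:1708.04268, §2.4 (the
  examples `x^p − t + …`) — context for `n = 2`, not used. [PatakfalviWaldron]
* A. J. de Jong, *Smoothness, semi-stability and alterations* (1996), 4.20–4.21 (finite birational onto normal
  is an isomorphism; tree `isIso_of_isFinite_of_isBirational`) — context, not used. [DeJong1996]
* Cruxes/PrimeFieldToPerfect/Disproof.lean §4 (s2); STRATEGY-CENSUS.md N3; KERNEL.md §4 (s2) — cell files, OURS.
-/

noncomputable section

set_option linter.dupNamespace false -- mandated namespace of this single-conjunct summit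

open _root_.CategoryTheory _root_.CategoryTheory.Limits _root_.AlgebraicGeometry
open Literature.AlgebraicGeometry.Resolution

namespace Summit.ResolutionOfSingularities.ResolutionOfSingularities.Theorems.CampaignW82

universe u

/-! ## A smooth FINITE model of a Frobenius twist -/

/-- [OURS · L1 W8.2] replaces the role of §17 ¶2, p.89 l.59–62 read with §2 p.4 l.22–24 («a perfect base field
K»; typed as `S17Methodology.U89_3_ours`) by naming the CHEAPEST model the finite level could supply; NOT a
statement of the manuscript. A SMOOTH FINITE MODEL OF A FROBENIUS TWIST: for a field `K` of exponential
characteristic `p` and `f₀ : X₀ ⟶ Spec K` there are `e : ℕ`, a scheme `Y` and a FINITE birational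
`π : Y ⟶ X₀^{(p^e)}` onto the Frobenius twist `X₀^{(p^e)} := X₀ ×_{K, Frob^e} Spec K`
(`pullback f₀ (Spec.map (iterateFrobenius K p e))`) whose composite with the projection `X₀^{(p^e)} ⟶ Spec K` is
`Smooth` — the predicate `HasSmoothFrobeniusTwistModel p K f₀` (p485672) with `IsProper π` sharpened to
`IsFinite π`, which it implies (`hasSmoothFrobeniusTwistModel_of_hasSmoothFiniteTwistModel`). When the twists of
`X₀` are integral (e.g. `IntegralOverPerfectClosure K f₀`), a smooth — hence normal, and by birationality
integral — `Y` finite birational over `X₀^{(p^e)}` IS its normalisation, so this reads «the NORMALISATION of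
some Frobenius twist of `X₀` is smooth over `K`» (strengthening (s2) of Cruxes/PrimeFieldToPerfect/Disproof.lean
§4 = strategist census N3). Vacuity: true when `f₀` is smooth (`e = 0`; anchor `hasSmoothFiniteTwistModel_of_smooth`); false for
`X₀ = Spec 𝔽_p(t^{1/p})` over `𝔽_p(t)` (every twist is one non-reduced point; already
`HasSmoothFrobeniusTwistModel` fails — barrier decl
`Literature.Barriers.ResolutionOfSingularities.not_hasResolution_Spec_frobTwist`); for Kollár's curve
`y² = x^p − t` over `𝔽_p(t)` it holds with `e = 1` (the twist `y² = (x − t)^p` normalises to a line; not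
proved here); for the surface `x^p − t + yz = 0` over `M(t)` it is refuted-in-intent by res-L1-s82-pv-2's
announced rung (every twist of level `≥ 1` is the normal non-regular `A_{p−1}` point `u^p = yz`, p515046
algebra; level `0` is regular non-smooth) — nothing of this is decided in this file. [folklore] -/
def HasSmoothFiniteTwistModel (p : ℕ) (K : Type u) [Field K] [ExpChar K p] {X₀ : Scheme.{u}}
    (f₀ : X₀ ⟶ Spec (.of K)) : Prop :=
  ∃ (e : ℕ) (Y : Scheme.{u})
    (π : Y ⟶ pullback f₀ (Spec.map (CommRingCat.ofHom (iterateFrobenius K p e)))),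
    IsFinite π ∧ IsBirational π ∧
      Smooth (π ≫ pullback.snd f₀ (Spec.map (CommRingCat.ofHom (iterateFrobenius K p e))))

/-! ## The finite-modification step at ONE constant field, full and regular forms -/

/-- [OURS · L1 W8.2] replaces the role of §17 ¶2, p.89 l.59–62 read with §2 p.4 l.22–24 («a perfect base field
K»; typed as `S17Methodology.U89_3_ours`) at transcendence degree one, OVER THE SINGLE FIELD `RatFunc M`, asking
for a FINITE (normalised-twist) model; NOT a statement of the manuscript. THE FINITE-MODIFICATION STEP at `M`
(characteristic `p`), grade `n`: under the hypothesis block of `PerfectionStepAt M n` (verbatim: every integral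
separated scheme of finite type of dimension `≤ n` over `RatFunc M` has a resolution), every separated
`f₀ : X₀ ⟶ Spec (RatFunc M)` of finite type with `topologicalKrullDim X₀ ≤ n` and
`IntegralOverPerfectClosure (RatFunc M) f₀` has `HasSmoothFiniteTwistModel p (RatFunc M) f₀` — «the normalisation of
some Frobenius twist of every irreducible geometrically reduced variety of dimension `≤ n` over `M(t)` is smooth
over `M(t)`», strengthening (s2) / census N3 of the residual `FrobeniusTwistStepAt p M n`, which it implies
(`frobeniusTwistStepAt_of_frobeniusTwistStepFiniteAt`). Status by the cell's records (nothing linked here): expected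
to hold at `n ≤ 1` (curves: the normalisation over the perfect closure is smooth and descends to a finite level —
census N3 «true for curves»; NOT in the tree under this name) and to FAIL at `n = 2` for every field `M` of
characteristic `p` by res-L1-s82-pv-2's announced rung (surface `x^p − t + yz = 0`; algebra p515046), where the
hypothesis block is a theorem only modulo FACT-LIST F-02 — so the by-name refutation will be either conditional on
F-02 or a refutation of the conclusion block, as for the bounded forms (p513490). Vacuity (prime `p`): trivially
true at `n = ⊥`, and true — though not proved here — at `n = 0`; never trivially false as typed; NOT implied by
`ResolutionInChar p` (resolutions are proper, not finite) — informative; NOT monotone in `n`. [folklore] -/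
def FrobeniusTwistStepFiniteAt (p : ℕ) [Fact p.Prime] (M : Type) [Field M] [CharP M p] (n : WithBot ℕ∞) :
    Prop :=
  (∀ (X : Scheme.{0}) (f : X ⟶ Spec (.of (RatFunc M))),
      IsSeparated f → LocallyOfFiniteType f → QuasiCompact f → IsIntegral X →
        topologicalKrullDim X ≤ n → Scheme.HasResolution X) →
    ∀ (X₀ : Scheme.{0}) (f₀ : X₀ ⟶ Spec (.of (RatFunc M))),
      IsSeparated f₀ → LocallyOfFiniteType f₀ → QuasiCompact f₀ → topologicalKrullDim X₀ ≤ n →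
        IntegralOverPerfectClosure (RatFunc M) f₀ → HasSmoothFiniteTwistModel p (RatFunc M) f₀

/-- [OURS · L1 W8.2] replaces the role of §17 ¶2, p.89 l.59–62 read with §2 p.4 l.22–24 («a perfect base field
K»; typed as `S17Methodology.U89_3_ours`) at transcendence degree one, OVER THE SINGLE FIELD `RatFunc M`, for
REGULAR varieties only, asking for a FINITE (normalised-twist) model; NOT a statement of the manuscript. THE
FINITE-MODIFICATION STEP FOR REGULAR VARIETIES at `M` (characteristic `p`), grade `n`: as
`FrobeniusTwistStepFiniteAt p M n` with the extra hypothesis `Scheme.IsRegular X₀` — «the normalisation of some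
Frobenius twist of every regular irreducible geometrically reduced variety of dimension `≤ n` over `M(t)` is smooth
over `M(t)`». Implied by the full finite step (`frobeniusTwistStepFiniteRegularAt_of_frobeniusTwistStepFiniteAt`);
implies `FrobeniusTwistStepRegularAt p M n` (p485672 v2;
`frobeniusTwistStepRegularAt_of_frobeniusTwistStepFiniteRegularAt`). Its body is inlined by
`frobeniusTwistStepFiniteRegularAt_iff` (`Iff.rfl`) for by-name links. Status by the cell's records (nothing linked
here): the witness of res-L1-s82-pv-2's announced rung «normalising the twists never suffices from dimension 2»
(surface `x^p − t + yz = 0` over `M(t)`, every `M` of characteristic `p`) IS regular and geometrically integral, so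
it addresses this regular form at `n = 2` directly (algebra p515046; nothing decided here); expected to hold at
`n ≤ 1` (census N3 «true for curves»; not in the tree under this name). Vacuity (prime `p`): trivially true at
`n = ⊥`, and true — though not proved here — at `n = 0`; never trivially false as typed; NOT implied by
`ResolutionInChar p`; NOT monotone in `n`. [folklore] -/
def FrobeniusTwistStepFiniteRegularAt (p : ℕ) [Fact p.Prime] (M : Type) [Field M] [CharP M p]
    (n : WithBot ℕ∞) : Prop :=
  (∀ (X : Scheme.{0}) (f : X ⟶ Spec (.of (RatFunc M))),
      IsSeparated f → LocallyOfFiniteType f → QuasiCompact f → IsIntegral X →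
        topologicalKrullDim X ≤ n → Scheme.HasResolution X) →
    ∀ (X₀ : Scheme.{0}) (f₀ : X₀ ⟶ Spec (.of (RatFunc M))),
      IsSeparated f₀ → LocallyOfFiniteType f₀ → QuasiCompact f₀ → topologicalKrullDim X₀ ≤ n →
        IntegralOverPerfectClosure (RatFunc M) f₀ → Scheme.IsRegular X₀ →
          HasSmoothFiniteTwistModel p (RatFunc M) f₀

/-! ## Anchors for the finite forms -/

/-- **The finite predicate, inlined** (definitional, `Iff.rfl`). [folklore] -/
theorem hasSmoothFiniteTwistModel_iff (p : ℕ) (K : Type u) [Field K] [ExpChar K p] {X₀ : Scheme.{u}}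
    (f₀ : X₀ ⟶ Spec (.of K)) :
    HasSmoothFiniteTwistModel p K f₀ ↔
      ∃ (e : ℕ) (Y : Scheme.{u})
        (π : Y ⟶ pullback f₀ (Spec.map (CommRingCat.ofHom (iterateFrobenius K p e)))),
        IsFinite π ∧ IsBirational π ∧
          Smooth (π ≫ pullback.snd f₀ (Spec.map (CommRingCat.ofHom (iterateFrobenius K p e)))) :=
  Iff.rfl

/-- **A smooth finite model of a twist is a smooth proper birational model of a twist** (Mathlib: a finite
morphism is proper). [folklore] -/
theorem hasSmoothFrobeniusTwistModel_of_hasSmoothFiniteTwistModel (p : ℕ) (K : Type u) [Field K] [ExpChar K p]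
    {X₀ : Scheme.{u}} (f₀ : X₀ ⟶ Spec (.of K)) (h : HasSmoothFiniteTwistModel p K f₀) :
    HasSmoothFrobeniusTwistModel p K f₀ := by
  obtain ⟨e, Y, π, h₁, h₂, h₃⟩ := h
  haveI := h₁
  exact ⟨e, Y, π, inferInstance, h₂, h₃⟩

/-- **Vacuity anchor: a smooth `X₀` has a smooth finite model of a twist** — exponent `e = 0`: `Spec (Frob^0)` is
an isomorphism (`Frob^0 = id`, Mathlib `iterateFrobenius_zero`), so `pullback.fst : X₀^{(p^0)} ⟶ X₀` is one, and
`π := (pullback.fst)⁻¹ : X₀ ⟶ X₀^{(p^0)}` is finite (an isomorphism) and birational (`U = ⊤`) with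
`π ≫ pullback.snd = f₀ ≫ (Spec (Frob^0))⁻¹` smooth. [folklore] -/
theorem hasSmoothFiniteTwistModel_of_smooth (p : ℕ) (K : Type u) [Field K] [ExpChar K p] {X₀ : Scheme.{u}}
    (f₀ : X₀ ⟶ Spec (.of K)) [Smooth f₀] : HasSmoothFiniteTwistModel p K f₀ := by
  haveI : IsIso (Spec.map (CommRingCat.ofHom (iterateFrobenius K p 0))) := by
    rw [iterateFrobenius_zero, CommRingCat.ofHom_id, Spec.map_id]; infer_instance
  refine ⟨0, X₀, inv (pullback.fst f₀ (Spec.map (CommRingCat.ofHom (iterateFrobenius K p 0)))),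
    inferInstance, ⟨⊤, by simp, by simp, inferInstance⟩, ?_⟩
  have h : inv (pullback.fst f₀ (Spec.map (CommRingCat.ofHom (iterateFrobenius K p 0)))) ≫
      pullback.snd f₀ (Spec.map (CommRingCat.ofHom (iterateFrobenius K p 0))) =
        f₀ ≫ inv (Spec.map (CommRingCat.ofHom (iterateFrobenius K p 0))) := by
    rw [IsIso.inv_comp_eq, ← Category.assoc, IsIso.eq_comp_inv]
    exact pullback.condition.symm
  rw [h]
  infer_instance

/-- **The finite step, inlined** (definitional, `Iff.rfl`). [folklore] -/
theorem frobeniusTwistStepFiniteAt_iff (p : ℕ) [Fact p.Prime] (M : Type) [Field M] [CharP M p]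
    (n : WithBot ℕ∞) :
    FrobeniusTwistStepFiniteAt p M n ↔
      ((∀ (X : Scheme.{0}) (f : X ⟶ Spec (.of (RatFunc M))),
          IsSeparated f → LocallyOfFiniteType f → QuasiCompact f → IsIntegral X →
            topologicalKrullDim X ≤ n → Scheme.HasResolution X) →
        ∀ (X₀ : Scheme.{0}) (f₀ : X₀ ⟶ Spec (.of (RatFunc M))),
          IsSeparated f₀ → LocallyOfFiniteType f₀ → QuasiCompact f₀ → topologicalKrullDim X₀ ≤ n →
            IntegralOverPerfectClosure (RatFunc M) f₀ →
              ∃ (e : ℕ) (Y : Scheme.{0})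
                (π : Y ⟶ pullback f₀ (Spec.map (CommRingCat.ofHom (iterateFrobenius (RatFunc M) p e)))),
                IsFinite π ∧ IsBirational π ∧
                  Smooth (π ≫ pullback.snd f₀
                    (Spec.map (CommRingCat.ofHom (iterateFrobenius (RatFunc M) p e))))) :=
  Iff.rfl

/-- **The regular finite step, inlined** (definitional, `Iff.rfl`): binder for binder the shape a by-name
refutation at `n = 2` (regular, geometrically integral surface `x^p − t + yz = 0`) would negate. [folklore] -/
theorem frobeniusTwistStepFiniteRegularAt_iff (p : ℕ) [Fact p.Prime] (M : Type) [Field M] [CharP M p]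
    (n : WithBot ℕ∞) :
    FrobeniusTwistStepFiniteRegularAt p M n ↔
      ((∀ (X : Scheme.{0}) (f : X ⟶ Spec (.of (RatFunc M))),
          IsSeparated f → LocallyOfFiniteType f → QuasiCompact f → IsIntegral X →
            topologicalKrullDim X ≤ n → Scheme.HasResolution X) →
        ∀ (X₀ : Scheme.{0}) (f₀ : X₀ ⟶ Spec (.of (RatFunc M))),
          IsSeparated f₀ → LocallyOfFiniteType f₀ → QuasiCompact f₀ → topologicalKrullDim X₀ ≤ n →
            IntegralOverPerfectClosure (RatFunc M) f₀ → Scheme.IsRegular X₀ →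
              ∃ (e : ℕ) (Y : Scheme.{0})
                (π : Y ⟶ pullback f₀ (Spec.map (CommRingCat.ofHom (iterateFrobenius (RatFunc M) p e)))),
                IsFinite π ∧ IsBirational π ∧
                  Smooth (π ≫ pullback.snd f₀
                    (Spec.map (CommRingCat.ofHom (iterateFrobenius (RatFunc M) p e))))) :=
  Iff.rfl

/-- **The finite step implies the Frobenius-twist step** (finite ⇒ proper, pointwise). [folklore] -/
theorem frobeniusTwistStepAt_of_frobeniusTwistStepFiniteAt {p : ℕ} [Fact p.Prime] {M : Type} [Field M]
    [CharP M p] {n : WithBot ℕ∞} (h : FrobeniusTwistStepFiniteAt p M n) : FrobeniusTwistStepAt p M n :=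
  fun hM X₀ f₀ hs hl hq hd hint =>
    hasSmoothFrobeniusTwistModel_of_hasSmoothFiniteTwistModel p (RatFunc M) f₀ (h hM X₀ f₀ hs hl hq hd hint)

/-- **The regular finite step is implied by the full finite step** (forget regularity). [folklore] -/
theorem frobeniusTwistStepFiniteRegularAt_of_frobeniusTwistStepFiniteAt {p : ℕ} [Fact p.Prime] {M : Type}
    [Field M] [CharP M p] {n : WithBot ℕ∞} (h : FrobeniusTwistStepFiniteAt p M n) :
    FrobeniusTwistStepFiniteRegularAt p M n :=
  fun hM X₀ f₀ hs hl hq hd hint _ => h hM X₀ f₀ hs hl hq hd hint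

/-- **The regular finite step implies the regular Frobenius-twist step** (finite ⇒ proper, pointwise).
[folklore] -/
theorem frobeniusTwistStepRegularAt_of_frobeniusTwistStepFiniteRegularAt {p : ℕ} [Fact p.Prime] {M : Type}
    [Field M] [CharP M p] {n : WithBot ℕ∞} (h : FrobeniusTwistStepFiniteRegularAt p M n) :
    FrobeniusTwistStepRegularAt p M n :=
  fun hM X₀ f₀ hs hl hq hd hint hreg =>
    hasSmoothFrobeniusTwistModel_of_hasSmoothFiniteTwistModel p (RatFunc M) f₀
      (h hM X₀ f₀ hs hl hq hd hint hreg)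

/-- **Pointwise use of the finite step** (instance-argument form: under the grade-`n` hypothesis block, a
separated `X₀` of finite type, dimension `≤ n`, integral over the perfect closure, has a smooth finite model of
some twist). Pure logic; fixes the binder order for users. [folklore] -/
theorem hasSmoothFiniteTwistModel_of_frobeniusTwistStepFiniteAt {p : ℕ} [Fact p.Prime] {M : Type} [Field M]
    [CharP M p] {n : WithBot ℕ∞} (h : FrobeniusTwistStepFiniteAt p M n)
    (hM : ∀ (X : Scheme.{0}) (f : X ⟶ Spec (.of (RatFunc M))),
      IsSeparated f → LocallyOfFiniteType f → QuasiCompact f → IsIntegral X →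
        topologicalKrullDim X ≤ n → Scheme.HasResolution X)
    {X₀ : Scheme.{0}} (f₀ : X₀ ⟶ Spec (.of (RatFunc M))) [IsSeparated f₀] [LocallyOfFiniteType f₀]
    [QuasiCompact f₀] (hd : topologicalKrullDim X₀ ≤ n) (hint : IntegralOverPerfectClosure (RatFunc M) f₀) :
    HasSmoothFiniteTwistModel p (RatFunc M) f₀ :=
  h hM X₀ f₀ inferInstance inferInstance inferInstance hd hint

end Summit.ResolutionOfSingularities.ResolutionOfSingularities.Theorems.CampaignW82

end
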